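import Mathlib
import Summits.ResolutionOfSingularities.ResolutionOfSingularities.Theorems.WildQuotientsWildQuotientResolutionStubQuotientModel
import Literature.AlgebraicGeometry.RelativeSpec.SymmetricPowerNormal
import Literature.AlgebraicGeometry.Resolution.FiniteBirationalNormal
import HarnessLib

/-!
# The normal quotient model `X♯/G → X₁` (crux `WildQuotients.WildQuotientResolution`, line `Sketch`)

Stub `stub_quotientModelNormal` of the skeleton `Sketch` (v5) for crux
stmt-ResolutionOfSingularities-15640 (route `ResolutionOfSingularities/WildQuotients`, card
`p-closure-sylow-separation`): the classical quotient glue (SGA 1, Exp. V, §1–2; Mumford,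
*Abelian Varieties*, §7) after Phase 0. It is the landed `QuotientModel.stub_quotientModel`
(`…Theorems.WildQuotientsWildQuotientResolutionStubQuotientModel`) — the quotient `Y₁ := X♯/G`
glued over `X₁` (`Literature.AlgebraicGeometry.RelativeSpec.FiniteGroupQuotientGluing`), with
`q♯ : X♯ → Y₁` finite, surjective, `G`-invariant, fibres the orbits, étale over a dense open, the
descended proper `r : Y₁ → X₁`, and the dense open `W ⊆ X₁` over which `r` is finite étale and
bijective — with TWO more conjuncts:

* `Y₁` is NORMAL when `X♯` is (`isIntegrallyClosed_stalk_glued_of_stalk`): every point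
  of `X♯/G` lies in a chart `Spec Γ(O, (π ≫ q)⁻¹U)^G ↪ O/G ↪ X♯/G` (`O` a `G`-stable open affine
  over `X₁`, `U ⊆ X₁` affine; `SubringDatum.fromSpec_preimage`), the ring `Γ(O, (π ≫ q)⁻¹U)` of
  sections of the normal integral `O` over a non-empty affine open is an integrally closed domain
  (`Resolution.isIntegrallyClosed_sections_of_stalk`), so is its ring of invariants
  (`ActionOver.isDomain_and_isIntegrallyClosed_invariantsRing`), and the local rings of the
  spectrum of an integrally closed domain are integrally closed
  (`Motives.isIntegrallyClosed_stalk_Spec`). This is the tree's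
  `ActionOver.isIntegrallyClosed_stalk_glued` (affine base) redone chart-by-chart over the affine
  opens of the separated base `X₁`.
* the lifted action `ρ♯` on `X♯` is FAITHFUL (`ρ♯ g = 1 ⇒ π ≫ ρ g = π ⇒ ρ g = 1`, `π` being
  dominant onto the reduced separated `X′`), as already proved inside `stub_quotientModel`.
-/

-- single-problem summit: the doubled namespace component `ResolutionOfSingularities` is forced
set_option linter.dupNamespace false

noncomputable section

universe u

open CategoryTheory Limits AlgebraicGeometry TopologicalSpace
open Literature.AlgebraicGeometry.Resolution Literature.AlgebraicGeometry.RelativeSpec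

namespace Summit.ResolutionOfSingularities.ResolutionOfSingularities.Theorems.WildQuotientResolution.QuotientModelNormal

/-! ## Normality of the glued quotient `X/G` over a separated base -/

section Normal

variable {X Y : Scheme.{u}} {r : X ⟶ Y} {G : Type*} [Group G] (ρ : ActionOver r G)
  [Finite G] [Y.IsSeparated] [IsSeparated r]

/-- **`X/G` is normal when `X` is a normal integral scheme** covered by `G`-stable opens affine
over the separated base `Y`: a point `z = π(x)`, `x ∈ O` (`O` stable, affine over `Y`), `r x ∈ U`
(`U ⊆ Y` affine open), lies in the open chart `Spec Γ(O, r⁻¹U)^G ↪ O/G ↪ X/G`; the ring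
`Γ(O, r⁻¹U)` (sections of the normal integral `O` over a non-empty affine open) is an integrally
closed domain, hence so is its ring of invariants, and the local rings of the spectrum of an
integrally closed domain are integrally closed. [cite: SGA1, Exp. V, §1, Prop. 1.1 and Cor. 1.2]
[cite: MumfordAV1970, §7 Thm. p. 66] -/
theorem isIntegrallyClosed_stalk_glued_of_stalk [IsIntegral X]
    (hcov : ∀ x : X, ∃ O : ρ.StableAffineOpens, x ∈ O.1)
    (hX : ∀ x : X, IsIntegrallyClosed (X.presheaf.stalk x)) (z : ρ.glued) :
    IsIntegrallyClosed (ρ.glued.presheaf.stalk z) := by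
  obtain ⟨x, hxz⟩ := ρ.gluedMk_surjective hcov z
  obtain ⟨O, hx⟩ := hcov x
  -- an affine open of the base around `r x`
  obtain ⟨U, hxU⟩ : ∃ U : Y.affineOpens, r.base x ∈ (U : Y.Opens) := by
    obtain ⟨U, hU, hxU, -⟩ :=
      exists_isAffineOpen_mem_and_subset (X := Y) (x := r.base x) (U := ⊤) (Opens.mem_top _)
    exact ⟨⟨U, hU⟩, hxU⟩
  -- the open subscheme `O` is integral with integrally closed local rings
  haveI : Nonempty (O.1 : Scheme.{u}) := ⟨⟨x, hx⟩⟩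
  haveI : IsIntegral (O.1 : Scheme.{u}) := isIntegral_of_isOpenImmersion O.1.ι
  have hOst : ∀ y : (O.1 : Scheme.{u}),
      IsIntegrallyClosed ((O.1 : Scheme.{u}).presheaf.stalk y) := fun y => by
    haveI := hX (O.1.ι.base y)
    exact IsIntegrallyClosed.of_equiv (asIso (O.1.ι.stalkMap y)).commRingCatIsoToRingEquiv
  -- the sections of `O` over the non-empty affine open `(O ↪ X → Y)⁻¹ U` form an integrally
  -- closed domain
  have hxU' : (⟨x, hx⟩ : (O.1 : Scheme.{u})) ∈ (O.1.ι ≫ r) ⁻¹ᵁ (U : Y.Opens) := by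
    show (O.1.ι ≫ r).base ⟨x, hx⟩ ∈ (U : Y.Opens)
    rw [Scheme.Hom.comp_base, TopCat.comp_app]
    exact hxU
  haveI : Nonempty ((O.1.ι ≫ r) ⁻¹ᵁ (U : Y.Opens) : (O.1 : Scheme.{u}).Opens) := ⟨⟨_, hxU'⟩⟩
  haveI : IsDomain Γ((O.1 : Scheme.{u}), (O.1.ι ≫ r) ⁻¹ᵁ (U : Y.Opens)) :=
    IsIntegral.component_integral _
  haveI : IsIntegrallyClosed Γ((O.1 : Scheme.{u}), (O.1.ι ≫ r) ⁻¹ᵁ (U : Y.Opens)) :=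
    isIntegrallyClosed_sections_of_stalk hOst ⟨(O.1.ι ≫ r) ⁻¹ᵁ (U : Y.Opens), U.2.preimage _⟩
  -- hence so does the ring of invariants, and the stalks of its spectrum are integrally closed
  obtain ⟨h1, h2⟩ := (ρ.restrict O.1 O.2.1).isDomain_and_isIntegrallyClosed_invariantsRing U
  -- `z` lies in the chart `Spec Γ(O, r⁻¹U)^G ↪ O/G ↪ X/G`
  have hmem : ρ.pieceMk O ⟨x, hx⟩ ∈
      (ρ.restrict O.1 O.2.1).invariants.fromSpec ⁻¹ᵁ (U : Y.Opens) := by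
    show ((ρ.restrict O.1 O.2.1).toQuotient ≫ (ρ.restrict O.1 O.2.1).quotientToBase).base
      ⟨x, hx⟩ ∈ (U : Y.Opens)
    rw [(ρ.restrict O.1 O.2.1).toQuotient_quotientToBase]
    exact hxU'
  rw [(ρ.restrict O.1 O.2.1).invariants.fromSpec_preimage U] at hmem
  obtain ⟨p, hp⟩ := hmem
  have hpz : ((ρ.restrict O.1 O.2.1).invariants.openCover.f U ≫ ρ.gluedι O).base p = z := by
    rw [Scheme.Hom.comp_base, TopCat.comp_app, hp, ← ρ.gluedMk_apply hcov O ⟨x, hx⟩]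
    exact hxz
  subst hpz
  have h := @Literature.AlgebraicGeometry.Motives.isIntegrallyClosed_stalk_Spec
    (.of ((ρ.restrict O.1 O.2.1).invariants.ring U)) h1 h2 p
  exact @IsIntegrallyClosed.of_equiv _ _ _ _
    (asIso ((((ρ.restrict O.1 O.2.1).invariants.openCover.f U ≫
      ρ.gluedι O).stalkMap p))).commRingCatIsoToRingEquiv.symm h

end Normal

/-! ## The stub -/

/-- STUB `stub_quotientModelNormal` (L, classical — SGA1 V §1–2; skeleton v5 = the LANDED
`QuotientModel.stub_quotientModel` with TWO more conjuncts). For the crux data with FAITHFUL `ρ`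
and a `G`-equivariant proper birational integral NORMAL model `π : X♯ → X′` with a `G`-stable
affine cover: the quotient `Y₁ := X♯/G` over `k` — separated, locally of finite type,
quasi-compact, integral, and NORMAL (its local rings are localisations of rings of invariants
`Γ(O, (π ≫ q)⁻¹U)^G` of integrally closed domains, `O` a stable affine, `U ⊆ X₁` affine:
`isIntegrallyClosed_stalk_glued_of_stalk`) — with the lifted action FAITHFUL
(`ρ♯ g = 1 ⇒ π ≫ ρ g = π ⇒ ρ g = 1`, `π` dominant onto the reduced separated `X′`),
`q♯ : X♯ → Y₁` finite, surjective, `G`-invariant, fibres the `G`-orbits, étale over a dense open;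
the induced `r : Y₁ → X₁` with `q♯ ≫ r = π ≫ q` and `r ≫ f = g`, proper; and a dense open
`W ⊆ X₁` over which `r` is finite, étale and bijective on points
(`QuotientModel.exists_dense_isFinite_etale_bijective`). [cite: SGA1, Exp. V, §1–2, Prop. 1.1,
Prop. 1.8 and Prop. 2.6] [cite: MumfordAV1970, §7 Thm. p. 66] -/
theorem stub_quotientModelNormal (p : ℕ) (k : Type) [Field k] [CharP k p]
    (X' X₁ : Scheme.{0}) (f : X₁ ⟶ Spec (.of k)) (q : X' ⟶ X₁) (G : Type) [Group G] [Finite G]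
    (ρ : G →* Aut X') (hfaith : Function.Injective ρ)
    [IsSeparated f] [LocallyOfFiniteType f] [QuasiCompact f] [IsIntegral X₁] [IsIntegral X']
    [IsFinite q] (hsurj : Function.Surjective q.base)
    (hU : ∃ U : X₁.Opens, Dense (U : Set X₁) ∧ Etale (q ∣_ U))
    (hρ : ∀ g : G, (ρ g).hom ≫ q = q)
    (horb : ∀ x y : X', q.base x = q.base y → ∃ g : G, (ρ g).hom.base x = y)
    (Xs : Scheme.{0}) (π : Xs ⟶ X') (ρs : G →* Aut Xs) [IsProper π] (hbir : IsBirational π)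
    [IsIntegral Xs] (hXsnorm : ∀ x : Xs, IsIntegrallyClosed (Xs.presheaf.stalk x))
    (hequiv : ∀ g : G, (ρs g).hom ≫ π = π ≫ (ρ g).hom)
    (hcov : ∀ x : Xs, ∃ U : Xs.Opens, IsAffineOpen U ∧ x ∈ U ∧ ∀ g : G, (ρs g).hom ⁻¹ᵁ U = U) :
    ∃ (Y₁ : Scheme.{0}) (g : Y₁ ⟶ Spec (.of k)) (qs : Xs ⟶ Y₁) (r : Y₁ ⟶ X₁),
      IsSeparated g ∧ LocallyOfFiniteType g ∧ QuasiCompact g ∧ IsIntegral Y₁ ∧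
      (∀ y : Y₁, IsIntegrallyClosed (Y₁.presheaf.stalk y)) ∧ Function.Injective ρs ∧
      IsFinite qs ∧ Function.Surjective qs.base ∧
      (∃ V : Y₁.Opens, Dense (V : Set Y₁) ∧ Etale (qs ∣_ V)) ∧
      (∀ g : G, (ρs g).hom ≫ qs = qs) ∧
      (∀ x y : Xs, qs.base x = qs.base y → ∃ g : G, (ρs g).hom.base x = y) ∧
      IsProper r ∧ qs ≫ r = π ≫ q ∧ r ≫ f = g ∧
      ∃ W : X₁.Opens, Dense (W : Set X₁) ∧ IsFinite (r ∣_ W) ∧ Etale (r ∣_ W) ∧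
        Function.Bijective (r ∣_ W).base := by
  classical
  -- separatedness and noetherianity downstairs
  haveI : X₁.IsSeparated := ⟨by rw [← terminal.comp_from f]; infer_instance⟩
  haveI : X'.IsSeparated := ⟨by rw [← terminal.comp_from (q ≫ f)]; infer_instance⟩
  haveI : IsLocallyNoetherian X₁ := LocallyOfFiniteType.isLocallyNoetherian f
  -- the action over `X₁` and its cover by `G`-stable opens affine over `X₁`
  let ρB : ActionOver (π ≫ q) G :=
    ⟨ρs, fun g => by rw [← Category.assoc, hequiv g, Category.assoc, hρ g]⟩
  have hcov' : ∀ x : Xs, ∃ O : ρB.StableAffineOpens, x ∈ O.1 := by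
    intro x
    obtain ⟨U, hU, hxU, hUst⟩ := hcov x
    haveI : IsAffine U := hU
    exact ⟨⟨U, hUst, isAffineHom_of_isAffine_of_isSeparated _⟩, hxU⟩
  -- the action on `X♯` is faithful: `π` is dominant onto the reduced separated `X′`
  haveI : IsDominant π := hbir.isDominant
  have hinj : Function.Injective ρB.aut := by
    intro g₁ g₂ h
    rw [← inv_mul_eq_one]
    apply hfaith
    rw [map_one]
    have h1 : ρs (g₁⁻¹ * g₂) = 1 := by
      rw [map_mul, map_inv, inv_mul_eq_one]
      exact h
    have h2 : π ≫ (ρ (g₁⁻¹ * g₂)).hom = π ≫ 𝟙 X' := by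
      rw [Category.comp_id, ← hequiv, h1]
      exact Category.id_comp π
    have h3 : (ρ (g₁⁻¹ * g₂)).hom = 𝟙 X' := ext_of_isDominant π h2
    ext : 1
    exact h3
  -- the quotient `Y₁ := X♯/G` over `X₁`, `q♯ : X♯ → Y₁`, `r : Y₁ → X₁`
  haveI hY₁ : IsIntegral ρB.glued := ρB.isIntegral_glued hcov'
  haveI hr : IsProper (ρB.gluedDesc (π ≫ q) ρB.aut_comp) :=
    ρB.isProper_gluedDesc hcov' (π ≫ q) ρB.aut_comp (𝟙 X₁) (Category.comp_id _)
  have hqr : ρB.gluedMk hcov' ≫ ρB.gluedDesc (π ≫ q) ρB.aut_comp = π ≫ q :=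
    ρB.gluedMk_gluedDesc hcov' _ _
  -- `Y₁` is normal: `X♯` is
  have hnorm : ∀ y : ρB.glued, IsIntegrallyClosed (ρB.glued.presheaf.stalk y) :=
    isIntegrallyClosed_stalk_glued_of_stalk ρB hcov' hXsnorm
  obtain ⟨W, hWd, hWfin, hWet, hWbij⟩ :=
    QuotientModel.exists_dense_isFinite_etale_bijective π q ρB hcov' hinj ρ hequiv horb hsurj hU
      hbir
  exact ⟨ρB.glued, ρB.gluedDesc (π ≫ q) ρB.aut_comp ≫ f, ρB.gluedMk hcov',
    ρB.gluedDesc (π ≫ q) ρB.aut_comp, inferInstance, inferInstance, inferInstance, hY₁, hnorm,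
    hinj, ρB.isFinite_gluedMk hcov', ρB.gluedMk_surjective hcov',
    exists_dense_etale_gluedMk_morphismRestrict ρB hcov' hinj, ρB.aut_hom_gluedMk hcov',
    fun x y hxy => ρB.exists_aut_apply_eq_of_gluedMk_eq hcov' hxy, hr, hqr, rfl, W, hWd, hWfin,
    hWet, hWbij⟩

end Summit.ResolutionOfSingularities.ResolutionOfSingularities.Theorems.WildQuotientResolution.QuotientModelNormal

end
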